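import Summits.BirchSwinnertonDyer.BirchSwinnertonDyer.Theorems.AlignedTransportAtTwoMainConjectureOfRankZeroBSDAtTwoSelmerLayerOneMatching
import Summits.BirchSwinnertonDyer.BirchSwinnertonDyer.Theorems.AlignedTransportAtTwoMainConjectureOfRankZeroBSDAtTwoCyclotomicLayerRankBudget
import HarnessLib

/-!
# Route `AlignedTransportAtTwo`, crux C2 `MainConjectureOfRankZeroBSDAtTwo` (stmt-BirchSwinnertonDyer-22298):
# THE `λ`-BUDGET OF SELMER GROWTH — `∑_{n ∈ S} pⁿ(p−1) ≤ λ(f_X)` over any finite set `S` of layers where the `p^∞`-SELMER corank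
# grows from `K_n` to `K_{n+1}` (Ш counts) and Greenberg's `ker g_n` is finite; unconditionally at the first layer over `ℚ`;
# and NO SELMER GROWTH BEYOND THE BUDGET: `pⁿ(p−1) > λ(f_X)` and `ker g_n` finite ⟹ `corank Sel(E_{K_{n+1}}) ≤ corank Sel(E_{K_n})`

HONEST FRAMING (cell `bsd-f1-sign2`, WIDTH-5 attached prover seat `bsd-line-att-p5` gen 40 on line `birth` of the lead
`bsd-line-att-p2`; `--supports` stmt-BirchSwinnertonDyer-22298, closes nothing; BSD is NOT proved by any of this; the crux
C2, its verdict «blocked-on `Rank1Residual.GreenbergMuConjectureIrreducible`» and every registered stub are untouched).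
THEOREMS ONLY — no `def`, no instance, no named fact, no `sorry`. The Ш-INCLUSIVE twin of g37's `…CyclotomicLayerRankBudget`
(there: Mordell–Weil growth layers, `sum_totient_growthLayers_le_lam`, `mordellWeilRank_layer_succ_eq_of_lam_lt`): the layer dichotomy is
now `…SelmerLayerGrowthDichotomy.selmerCorank_layer_succ_le_or_cyclotomicLayer_dvd_of_finite_kerG` (a Selmer-corank jump at `n → n+1`
puts the prime `Ψ_{n+1}` into `f_X`, given `ker g_n` finite), and g37's pure-algebra count `sum_totient_le_lam_of_forall_dvd` does the rest.

* ★★★ `sum_totient_selmerGrowthLayers_le_lam_of_finite_kerG` — **`∑_{n∈S} pⁿ(p−1) ≤ λ(f_X)`** for Selmer growth layers `S` with `ker g_n`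
  finite (`n ∈ S`); `…_le_lambdaInvariant` (`= λ(X)`);
* ★★★ `selmerCorank_layer_succ_le_of_lam_lt_of_finite_kerG` — **`pⁿ(p−1) > λ(f_X)`, `ker g_n` finite ⟹ `corank Sel_{p^∞}(E_{K_{n+1}}/K_{n+1})
  ≤ corank Sel_{p^∞}(E_{K_n}/K_n)`** (no new points AND no new Ш-corank in the layer `K_{n+1}/K_n`);
* ★★ over `ℚ`, good ordinary `p`, first layer, UNCONDITIONAL: `totient_le_lam_of_selmerCorank_lt_layer_one` (**a Selmer jump `ℚ → ℚ_1` costs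
  `p − 1 ≤ λ(f_X)`**) and `selmerCorank_layer_one_le_of_lam_lt` (**`λ(f_X) < p − 1 ⟹ corank Sel_{p^∞}(E_{ℚ_1}/ℚ_1) ≤ corank Sel_{p^∞}(E/ℚ)`**).

References: R. Greenberg, LNM 1716 (1999), Thm. 1.9 (p. 63), §5 p. 132, Thm. 1.2 [GreenbergLNM1716]; L. Washington, GTM 83, §7.1, §13.2
[Washington1997].
-/

set_option linter.dupNamespace false
set_option autoImplicit false

noncomputable section

open scoped Classical AddSubgroup Polynomial

universe u

namespace Summit.BirchSwinnertonDyer.BirchSwinnertonDyer.Theorems.AlignedTransportAtTwoSelmerLayerLambdaBudget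

open Polynomial WeierstrassCurve Literature.NumberTheory.EllipticCurves
  Summit.BirchSwinnertonDyer.Rank1Residual.X1.MuLambda
  Summit.BirchSwinnertonDyer.Rank1Residual.X1.ParitySqueeze
  Summit.BirchSwinnertonDyer.Rank1Residual.X1.CyclotomicZeros
  Summit.BirchSwinnertonDyer.BirchSwinnertonDyer.Theorems.AlignedTransportAtTwoSelmerLayerControl
  Summit.BirchSwinnertonDyer.BirchSwinnertonDyer.Theorems.AlignedTransportAtTwoSelmerLayerGrowthDichotomy
  Summit.BirchSwinnertonDyer.BirchSwinnertonDyer.Theorems.AlignedTransportAtTwoSelmerLayerOneMatching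
  Summit.BirchSwinnertonDyer.BirchSwinnertonDyer.Theorems.AlignedTransportAtTwoCyclotomicLayerPrime
  Summit.BirchSwinnertonDyer.BirchSwinnertonDyer.Theorems.AlignedTransportAtTwoCyclotomicLayerRankBudget

section Budget

variable {K : Type u} [Field K] [NumberField K] (W : WeierstrassCurve K) [W.IsElliptic] {p : ℕ} [hp : Fact p.Prime]
  (κ : ZpExtension K p) {γ : Field.absoluteGaloisGroup K}

omit [W.IsElliptic] in
/-- `f_X ≠ 0` when `char_Λ X = (f_X)` (`char_Λ X ≠ ⊥`). [folklore] -/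
theorem charGen_ne_zero (D : W.SelmerDualData κ γ) [Module.Finite (IwasawaAlgebra p) D.X] {fE : IwasawaAlgebra p}
    (hfE : D.charIdeal = Ideal.span {fE}) : fE ≠ 0 := by
  intro h0
  refine Module.charIdeal_ne_bot (IwasawaAlgebra p) D.X ?_
  change D.charIdeal = ⊥
  rw [hfE, h0]
  exact Ideal.span_singleton_eq_bot.mpr rfl

/-- ★★★ **THE `λ`-BUDGET OF SELMER GROWTH.** For `E/K` elliptic, ANY `ℤ_p`-extension with topological generator `γ`, a dual datum with `X` f.g.
torsion and `char_Λ X = (f_X)`, and a finite set `S` of layers such that for `n ∈ S` Greenberg's `ker g_n` is finite and the `p^∞`-SELMER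
corank GROWS from `K_n` to `K_{n+1}` (more points or more `Ш[p^∞]`-corank): **`∑_{n∈S} pⁿ(p−1) ≤ λ(f_X)`** — each such layer contributes
its own prime `Ψ_{n+1} = Φ_{p^{n+1}}(1+T)` to `f_X` (`…SelmerLayerGrowthDichotomy`), and g37's `sum_totient_le_lam_of_forall_dvd` counts.
[cite: GreenbergLNM1716, Thm. 1.9 (p. 63) and §5 p. 132] -/
theorem sum_totient_selmerGrowthLayers_le_lam_of_finite_kerG (hγ : κ.IsTopGenerator γ) (D : W.SelmerDualData κ γ)
    [Module.Finite (IwasawaAlgebra p) D.X] (hD : D.IsTorsion) {fE : IwasawaAlgebra p} (hfE : D.charIdeal = Ideal.span {fE})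
    (S : Finset ℕ) (hfin : ∀ n ∈ S, Finite (W.KerG κ n))
    (hS : ∀ n ∈ S, (W.baseChange (κ.layer n)).selmerCorank p < (W.baseChange (κ.layer (n + 1))).selmerCorank p) :
    ∑ n ∈ S, p ^ n * (p - 1) ≤ lam fE := by
  refine sum_totient_le_lam_of_forall_dvd S (charGen_ne_zero W κ D hfE) fun n hn ↦ ?_
  haveI := hfin n hn
  rcases selmerCorank_layer_succ_le_or_cyclotomicLayer_dvd_of_finite_kerG W κ hγ D hD n hfE with h | h
  · exact absurd h (not_le.mpr (hS n hn))
  · exact h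

/-- In the tree's invariant: **`∑_{n∈S} pⁿ(p−1) ≤ λ(X)`** (`lambdaInvariant`; `lam_generator_eq_lambdaInvariant`).
[cite: GreenbergLNM1716, Thm. 1.9 (p. 63) and §5 p. 132] -/
theorem sum_totient_selmerGrowthLayers_le_lambdaInvariant_of_finite_kerG (hγ : κ.IsTopGenerator γ) (D : W.SelmerDualData κ γ)
    [Module.Finite (IwasawaAlgebra p) D.X] (hD : D.IsTorsion) {fE : IwasawaAlgebra p} (hfE : D.charIdeal = Ideal.span {fE})
    (S : Finset ℕ) (hfin : ∀ n ∈ S, Finite (W.KerG κ n))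
    (hS : ∀ n ∈ S, (W.baseChange (κ.layer n)).selmerCorank p < (W.baseChange (κ.layer (n + 1))).selmerCorank p) :
    ∑ n ∈ S, p ^ n * (p - 1) ≤ lambdaInvariant p D.X := by
  rw [← lam_generator_eq_lambdaInvariant D.X hD (charGen_ne_zero W κ D hfE) hfE]
  exact sum_totient_selmerGrowthLayers_le_lam_of_finite_kerG W κ hγ D hD hfE S hfin hS

/-- ★★★ **NO SELMER GROWTH BEYOND THE `λ`-BUDGET**: if `pⁿ(p−1) > λ(f_X)` and `ker g_n` is finite then
`corank Sel_{p^∞}(E_{K_{n+1}}/K_{n+1}) ≤ corank Sel_{p^∞}(E_{K_n}/K_n)` — no new independent points AND no new `Ш[p^∞]`-corank in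
`K_{n+1}/K_n` (the Ш-inclusive twin of g37's `mordellWeilRank_layer_succ_eq_of_lam_lt`). [cite: GreenbergLNM1716, Thm. 1.9, §5 p. 132] -/
theorem selmerCorank_layer_succ_le_of_lam_lt_of_finite_kerG (hγ : κ.IsTopGenerator γ) (D : W.SelmerDualData κ γ)
    [Module.Finite (IwasawaAlgebra p) D.X] (hD : D.IsTorsion) {fE : IwasawaAlgebra p} (hfE : D.charIdeal = Ideal.span {fE})
    (n : ℕ) [Finite (W.KerG κ n)] (hlam : lam fE < p ^ n * (p - 1)) :
    (W.baseChange (κ.layer (n + 1))).selmerCorank p ≤ (W.baseChange (κ.layer n)).selmerCorank p := by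
  by_contra h
  have hsum := sum_totient_selmerGrowthLayers_le_lam_of_finite_kerG W κ hγ D hD hfE {n}
    (fun m hm ↦ by rw [Finset.mem_singleton.mp hm]; infer_instance)
    (fun m hm ↦ by rw [Finset.mem_singleton.mp hm]; exact not_le.mp h)
  rw [Finset.sum_singleton] at hsum
  omega

end Budget

/-! ## Over `ℚ`, first layer: unconditional -/

section RatLayerOne

variable (W : WeierstrassCurve ℚ) [W.IsElliptic] [W.IsGloballyMinimal] {p : ℕ} [hp : Fact p.Prime]
  {κ : ZpExtension ℚ p} {γ : Field.absoluteGaloisGroup ℚ}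

/-- ★★ **A first-layer Selmer jump costs `p − 1 ≤ λ(f_X)`, UNCONDITIONALLY** (`W/ℚ` globally minimal, good ordinary at `p`, the cyclotomic
`ℤ_p`-extension, `X` torsion with `char_Λ X = (f_X)`): `corank Sel_{p^∞}(E/ℚ) < corank Sel_{p^∞}(E_{ℚ_1}/ℚ_1) ⟹ ξ_p ∣ f_X`
(`…SelmerLayerOneMatching`) and `λ(ξ_p) = p − 1`. [cite: GreenbergLNM1716, Thm. 1.9, §5 p. 132] -/
theorem totient_le_lam_of_selmerCorank_lt_layer_one (hgood : W.HasGoodReductionAtPrime p) (hord : ¬ (p : ℤ) ∣ W.frobeniusTrace p)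
    (hκ : κ.IsCyclotomic) (hγ : κ.IsTopGenerator γ) (D : W.SelmerDualData κ γ) (hD : D.IsTorsion) {fE : IwasawaAlgebra p}
    (hfE : D.charIdeal = Ideal.span {fE}) (h : W.selmerCorank p < (W.baseChange (κ.layer 1)).selmerCorank p) :
    p - 1 ≤ lam fE := by
  haveI : Module.Finite (IwasawaAlgebra p) D.X := SelmerDualData.module_finite_of_isCyclotomic W κ hκ D hγ
  have hdvd := cyclotomicLayer_one_dvd_of_mem_charIdeal_of_selmerCorank_lt_layer_one W hgood hord hκ hγ D hD h
    (by rw [hfE]; exact Ideal.mem_span_singleton_self fE)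
  have h1 := sum_totient_le_lam_of_forall_dvd {0} (charGen_ne_zero W κ D hfE) fun n hn ↦ by
    rw [Finset.mem_singleton.mp hn]; exact hdvd
  simpa using h1

/-- ★★ **`λ(f_X) < p − 1 ⟹ corank Sel_{p^∞}(E_{ℚ_1}/ℚ_1) ≤ corank Sel_{p^∞}(E/ℚ)`, UNCONDITIONALLY** (no new points and no new
`Ш[p^∞]`-corank in the first cyclotomic layer when the `λ`-budget is below `p − 1`). [cite: GreenbergLNM1716, Thm. 1.9, §5 p. 132] -/
theorem selmerCorank_layer_one_le_of_lam_lt (hgood : W.HasGoodReductionAtPrime p) (hord : ¬ (p : ℤ) ∣ W.frobeniusTrace p)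
    (hκ : κ.IsCyclotomic) (hγ : κ.IsTopGenerator γ) (D : W.SelmerDualData κ γ) (hD : D.IsTorsion) {fE : IwasawaAlgebra p}
    (hfE : D.charIdeal = Ideal.span {fE}) (hlam : lam fE < p - 1) :
    (W.baseChange (κ.layer 1)).selmerCorank p ≤ W.selmerCorank p := by
  by_contra h
  have := totient_le_lam_of_selmerCorank_lt_layer_one W hgood hord hκ hγ D hD hfE (not_le.mp h)
  omega

end RatLayerOne

end Summit.BirchSwinnertonDyer.BirchSwinnertonDyer.Theorems.AlignedTransportAtTwoSelmerLayerLambdaBudget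

end
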